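import Summits.Ventures.LatticeQCDFlow.Scaling.ClusteringFloorStrongCoupling
import Summits.Ventures.LatticeQCDFlow.Scaling.U1OneLink
import Literature.MathematicalPhysics.QuantumFieldTheory.LatticeGaugeStaticPotentialProofs

/-!
HONEST FRAMING: exact (Metropolis-corrected) sampling algorithms for lattice gauge theory; figures
of merit are autocorrelation/cost numbers at stated couplings and volumes; no continuum-physics
claim.

# ClusteringFloorAnyAxis — (U″) AT STRONG COUPLING FOR EVERY PLANE `(i, j)` AND EVERY TRANSVERSE
# SEPARATION AXIS `a ∉ {i, j}`, BY THE AXIS-PERMUTATION AND ORIENTATION SYMMETRIES OF THE TORUS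
# (lean-1 GEN-11, ours; supplement to `ClusteringFloorStrongCoupling`)

Venture-side (OURS). Cell `lqcd-flow` (pub-lqcd), unit `pub-lqcd-lean-1-g11`, 2026-08-23.
`ClusteringFloorStrongCoupling` decides `Conjectures.ClusteringFloor d N G ρ β i j 0` (separation in
TIME of spatial plaquettes `0 < i < j`) at strong coupling.  The conjecture is a statement about the
Wilson measure, which is invariant under the permutations of the coordinate axes (Literature
`wilsonExpectation_comp_configPerm`, `plaquetteHolonomy_configPerm`) and whose plaquette observable
is unchanged by reversing the orientation of the plane (`Re tr ρ(U⁻¹) = Re tr ρ(U)` on a compact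
group, Literature `CompactGroup.re_trace_map_inv`).  Hence:

* `clusteringFloor_perm` — `ClusteringFloor d N G ρ β i j a → ClusteringFloor d N G ρ β (π i) (π j) (π a)`
  for every permutation `π` of the axes (same constants);
* `clusteringFloor_swap` — `ClusteringFloor d N G ρ β i j a → ClusteringFloor d N G ρ β j i a`;
* **`clusteringFloor_of_oneLink_transverse`** — for every `(G, ρ)` with one-link data and all pairwise
  distinct `i, j, a`: `∃ β₀ > 0, ∀ β ∈ (0, β₀], ClusteringFloor d N G ρ β i j a` (the swap `0 ↔ a`
  reduces to the time-direction theorem), with the `SU(N)` (`N ≥ 2`) and `U(1)` instances and the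
  repaired form (U″-R) for `a ∉ {i, j}`.

NOT CLAIMED: `a ∈ {i, j}` (plaquettes separated inside their own plane — (U′) at `R = 0` is not in
the tree for that geometry); intermediate `β`.  [folklore] symmetries; new docking only.
-/

noncomputable section

namespace Summit.Ventures.LatticeQCDFlow.Theory2.Clustering

open MeasureTheory Literature.MathematicalPhysics.QuantumFieldTheory
open Literature.MathematicalPhysics.QuantumLattice (fundamentalRep continuous_fundamentalRep u1Rep
  continuous_u1Rep)
open Summit.Ventures.LatticeQCDFlow.Conjectures

section Symmetry

variable {d N : ℕ} {G : Type} [Group G] [TopologicalSpace G] [IsTopologicalGroup G]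
  [CompactSpace G] [MeasurableSpace G] [BorelSpace G] (ρ : G →* Matrix (Fin N) (Fin N) ℂ)

/-- **Axis permutations transport the clustering floor** (same `κ₀, ξ, L₀`). -/
theorem clusteringFloor_perm (hρ : Continuous ρ) {β : ℝ} {i j a : Fin d} (π : Equiv.Perm (Fin d))
    (h : ClusteringFloor d N G ρ β i j a) : ClusteringFloor d N G ρ β (π i) (π j) (π a) := by
  obtain ⟨κ₀, hκ, ξ, hξ, L₀, h⟩ := h
  refine ⟨κ₀, hκ, ξ, hξ, L₀, fun L _ hL s hs x => ?_⟩
  have key := h L hL s hs (sitePerm π.symm x)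
  -- transport each of the three expectations along `configPerm π`
  have hsh : sitePerm π.symm (x + Pi.single (π a) ((s : ℕ) : ZMod L))
      = sitePerm π.symm x + Pi.single a ((s : ℕ) : ZMod L) := by
    rw [sitePerm_add, sitePerm_single, Equiv.symm_apply_apply]
  have e1 := wilsonExpectation_comp_configPerm ρ hρ β π (fun U : GaugeConfig d L G =>
    (ρ (plaquetteHolonomy U x (π i) (π j))).trace.re
      * (ρ (plaquetteHolonomy U (x + Pi.single (π a) ((s : ℕ) : ZMod L)) (π i) (π j))).trace.re)
  have e2 := wilsonExpectation_comp_configPerm ρ hρ β π (fun U : GaugeConfig d L G =>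
    (ρ (plaquetteHolonomy U x (π i) (π j))).trace.re)
  have e3 := wilsonExpectation_comp_configPerm ρ hρ β π (fun U : GaugeConfig d L G =>
    (ρ (plaquetteHolonomy U (x + Pi.single (π a) ((s : ℕ) : ZMod L)) (π i) (π j))).trace.re)
  simp only [Function.comp_def, plaquetteHolonomy_configPerm, Equiv.symm_apply_apply, hsh] at e1 e2 e3
  rw [← e1, ← e2, ← e3]
  exact key

omit [MeasurableSpace G] [BorelSpace G] in
/-- Reversing the orientation of the plane inverts the holonomy and keeps `Re tr ρ`. [folklore] -/
theorem plaqObs_swap (hρ : Continuous ρ) {L : ℕ} (U : GaugeConfig d L G) (x : Site d L) (i j : Fin d) :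
    (ρ (plaquetteHolonomy U x j i)).trace.re = (ρ (plaquetteHolonomy U x i j)).trace.re := by
  have hinv : plaquetteHolonomy U x j i = (plaquetteHolonomy U x i j)⁻¹ := by
    simp only [plaquetteHolonomy]; group
  rw [hinv, Literature.RepresentationTheory.CompactGroups.CompactGroup.re_trace_map_inv ρ hρ]

/-- **Orientation reversal transports the clustering floor.** -/
theorem clusteringFloor_swap (hρ : Continuous ρ) {β : ℝ} {i j a : Fin d}
    (h : ClusteringFloor d N G ρ β i j a) : ClusteringFloor d N G ρ β j i a := by
  obtain ⟨κ₀, hκ, ξ, hξ, L₀, h⟩ := h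
  refine ⟨κ₀, hκ, ξ, hξ, L₀, fun L _ hL s hs x => ?_⟩
  have hsw : ∀ (U : GaugeConfig d L G) (y : Site d L),
      (ρ (plaquetteHolonomy U y j i)).trace.re = (ρ (plaquetteHolonomy U y i j)).trace.re :=
    fun U y => plaqObs_swap ρ hρ U y i j
  simp only [hsw]
  exact h L hL s hs x

end Symmetry

section Transverse

variable {d N : ℕ} [NeZero d] {G : Type} [Group G] [TopologicalSpace G] [IsTopologicalGroup G]
  [CompactSpace G] [MeasurableSpace G] [BorelSpace G] [SecondCountableTopology G]
  (ρ : G →* Matrix (Fin N) (Fin N) ℂ)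

omit [SecondCountableTopology G] in
/-- From the time-direction theorem for all spatial pairs to every transverse axis: if for all
`0 < i' < j'` the floor holds along the time axis, then it holds for every plane `(i, j)` and every
axis `a ∉ {i, j}` (swap the axes `0 ↔ a`; reverse the orientation if needed). -/
theorem clusteringFloor_transverse_of_time (hρ : Continuous ρ) {β : ℝ}
    (h0 : ∀ i' j' : Fin d, i' < j' → i' ≠ 0 → ClusteringFloor d N G ρ β i' j' 0)
    {i j a : Fin d} (hij : i ≠ j) (hai : a ≠ i) (haj : a ≠ j) :
    ClusteringFloor d N G ρ β i j a := by
  set π : Equiv.Perm (Fin d) := Equiv.swap 0 a with hπ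
  -- preimages of `i, j` under `π` (an involution): both nonzero and distinct
  have hπ0 : π 0 = a := by simp [hπ]
  have hi0 : π i ≠ 0 := by
    intro h
    have : i = π.symm 0 := by rw [← h, Equiv.symm_apply_apply]
    rw [Equiv.symm_swap, Equiv.swap_apply_left] at this
    exact hai this.symm
  have hj0 : π j ≠ 0 := by
    intro h
    have : j = π.symm 0 := by rw [← h, Equiv.symm_apply_apply]
    rw [Equiv.symm_swap, Equiv.swap_apply_left] at this
    exact haj this.symm
  have hne : π i ≠ π j := fun h => hij (π.injective h)
  have hππ : ∀ k, π (π k) = k := fun k => by simp [hπ, Equiv.swap_apply_self]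
  rcases lt_or_gt_of_ne hne with hlt | hgt
  · have h := clusteringFloor_perm ρ hρ π (h0 (π i) (π j) hlt hi0)
    rwa [hππ, hππ, hπ0] at h
  · have h := clusteringFloor_perm ρ hρ π (h0 (π j) (π i) hgt hj0)
    rw [hππ, hππ, hπ0] at h
    exact clusteringFloor_swap ρ hρ h

/-- **(U″) AT STRONG COUPLING, EVERY PLANE AND EVERY TRANSVERSE AXIS**, for every `(G, ρ)` with
one-link data: for pairwise distinct `i, j, a`,
`∃ β₀ > 0, ∀ β ∈ (0, β₀], Conjectures.ClusteringFloor d N G ρ β i j a`. -/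
theorem clusteringFloor_of_oneLink_transverse [NeZero N] {θ : ℝ} (h : GroupLayer.OneLink ρ θ)
    {i j a : Fin d} (hij : i ≠ j) (hai : a ≠ i) (haj : a ≠ j) :
    ∃ β₀ : ℝ, 0 < β₀ ∧ ∀ β : ℝ, 0 < β → β ≤ β₀ → ClusteringFloor d N G ρ β i j a := by
  classical
  -- one `β₀` for all spatial pairs: the minimum over the finitely many pairs
  have hfin : ∀ p : {p : Fin d × Fin d // p.1 < p.2 ∧ p.1 ≠ 0},
      ∃ β₀ : ℝ, 0 < β₀ ∧ ∀ β : ℝ, 0 < β → β ≤ β₀ → ClusteringFloor d N G ρ β p.1.1 p.1.2 0 :=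
    fun p => clusteringFloor_of_oneLink ρ h p.2.1 p.2.2
  choose b hb using hfin
  have hne : (Finset.univ : Finset {p : Fin d × Fin d // p.1 < p.2 ∧ p.1 ≠ 0}).Nonempty ∨
      ¬ (Finset.univ : Finset {p : Fin d × Fin d // p.1 < p.2 ∧ p.1 ≠ 0}).Nonempty := em _
  rcases hne with hne | hempty
  · refine ⟨Finset.univ.inf' hne b, (Finset.lt_inf'_iff hne).2 fun p _ => (hb p).1, ?_⟩
    intro β hβ hle
    refine clusteringFloor_transverse_of_time ρ h.cont (fun i' j' hlt hi' => ?_) hij hai haj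
    exact (hb ⟨(i', j'), hlt, hi'⟩).2 β hβ (hle.trans (Finset.inf'_le _ (Finset.mem_univ _)))
  · -- no spatial pair: then `i, j, a` cannot be pairwise distinct with a transverse axis
    exfalso
    apply hempty
    -- the pair `(π i, π j)` or `(π j, π i)` with `π = swap 0 a` is a spatial pair
    set π : Equiv.Perm (Fin d) := Equiv.swap 0 a with hπ
    have hi0 : π i ≠ 0 := by
      intro h
      have : i = π.symm 0 := by rw [← h, Equiv.symm_apply_apply]
      rw [Equiv.symm_swap, Equiv.swap_apply_left] at this
      exact hai this.symm
    have hj0 : π j ≠ 0 := by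
      intro h
      have : j = π.symm 0 := by rw [← h, Equiv.symm_apply_apply]
      rw [Equiv.symm_swap, Equiv.swap_apply_left] at this
      exact haj this.symm
    have hne : π i ≠ π j := fun h => hij (π.injective h)
    rcases lt_or_gt_of_ne hne with hlt | hgt
    · exact ⟨⟨(π i, π j), hlt, hi0⟩, Finset.mem_univ _⟩
    · exact ⟨⟨(π j, π i), hgt, hj0⟩, Finset.mem_univ _⟩

/-- The repaired item (U″-R) for every plane and every transverse axis, at strong coupling. -/
theorem clusteringFloorR_of_oneLink_transverse [NeZero N] {θ : ℝ} (h : GroupLayer.OneLink ρ θ)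
    {i j a : Fin d} (hai : a ≠ i) (haj : a ≠ j) :
    ∃ β₀ : ℝ, 0 < β₀ ∧ ∀ β : ℝ, β ≤ β₀ → ClusteringFloorR d N G ρ β i j a := by
  by_cases hij : i = j
  · refine ⟨1, one_pos, fun β _ => fun _ hne _ _ => absurd hij hne⟩
  · obtain ⟨β₀, hβ₀, hcl⟩ := clusteringFloor_of_oneLink_transverse ρ h hij hai haj
    exact ⟨β₀, hβ₀, fun β hle => fun _ _ hβ _ => hcl β hβ hle⟩

end Transverse

section Instances

variable {d N : ℕ} [NeZero d] {i j a : Fin d}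

/-- **(U″) at strong coupling for `SU(N)`, `N ≥ 2`, every plane and every transverse axis.** -/
theorem clusteringFloor_sun_transverse (hN : 2 ≤ N) (hij : i ≠ j) (hai : a ≠ i) (haj : a ≠ j) :
    ∃ β₀ : ℝ, 0 < β₀ ∧ ∀ β : ℝ, 0 < β → β ≤ β₀ →
      ClusteringFloor d N (Matrix.specialUnitaryGroup (Fin N) ℂ) (fundamentalRep (Fin N)) β i j a := by
  haveI := GroupLayer.secondCountableTopology_SU N
  haveI : NeZero N := ⟨by omega⟩
  exact clusteringFloor_of_oneLink_transverse (fundamentalRep (Fin N))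
    (GroupLayer.oneLink_fundamentalRep hN) hij hai haj

/-- **(U″) at strong coupling for `U(1)`, every plane and every transverse axis.** -/
theorem clusteringFloor_u1_transverse (hij : i ≠ j) (hai : a ≠ i) (haj : a ≠ j) :
    ∃ β₀ : ℝ, 0 < β₀ ∧ ∀ β : ℝ, 0 < β → β ≤ β₀ → ClusteringFloor d 1 Circle u1Rep β i j a :=
  clusteringFloor_of_oneLink_transverse u1Rep GroupLayer.oneLink_u1Rep hij hai haj

end Instances

end Summit.Ventures.LatticeQCDFlow.Theory2.Clustering
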